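import Literature.NumberTheory.Automorphic.AsaiAtOneOfAsaiHolomorphy
import HarnessLib

/-!
# Mok's Asai-pole dichotomy from Grbac–Shahidi's HOLOMORPHY (Thm. 4.3 (1), (2)(a)) in `L²_cusp`
# and the `L²` facts of Jacquet–Shalika — at EVERY Asai datum, with no enlargement of `S`

Topic `NumberTheory/Automorphic`; namespace `Literature.NumberTheory.Automorphic`. Proof file
(theorems only: no definition, no named fact, no instance) of the provefact unit
`Mok2014_partialAsaiL_continuation_pole_dichotomy` (`AsaiSignCont`), sibling of
`AsaiSignContProofs` (`Mok2014_partialAsaiL_continuation_pole_dichotomy_of_holomorphy`: the fact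
from a holomorphy hypothesis `hHol` on `{1/2 < Re s}` and a Rankin–Selberg hypothesis `hRS` for the
pair `(Π, Π^c)` at every Asai datum), of `AsaiSignContProofsL2` (the same with `hRS` fed from the
`L²` facts at LARGE data, at the price of a non-vanishing hypothesis `hNV` on the removed local
factors) and of `AsaiAtOneOfAsaiHolomorphy` (the unit `GrbacShahidi2015_partialAsaiL_at_one`, whose
hypothesis `hGS` — Grbac–Shahidi 2015, Thm. 4.3 (1), (2)(a) for the partial Asai `L`-functions of
the cuspidal `Π₀ ≤ L²_cusp(GL_N(E) A_G \ GL_N(𝔸_E))`, requested there as the cite item / named fact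
`GrbacShahidi2015_partialAsaiL_holomorphy` — is taken over VERBATIM here).

## What is proved

* `Mok2014_partialAsaiL_continuation_pole_dichotomy_of_asaiHolomorphy_of_L2` (**main**) — Mok's
  dichotomy (`Mok2014_partialAsaiL_continuation_pole_dichotomy`, every rank `N ≥ 1`, every Asai
  datum) follows from `hGS` and the tree's NAMED FACTS `JacquetShalika1981_partialPairL_at_one_of_ne_conj`
  (`h22`), `JacquetShalika1981_partialPairL_boundary_of_ne_one` (`h22'`),
  `JacquetShalika1981_partialPairL_pole_of_eq_conj` (`h23`) and `multiplicity_one_gl` (`hm1`) — the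
  SAME five hypotheses, letter for letter, as
  `GrbacShahidi2015_partialAsaiL_at_one_of_asaiHolomorphy_of_L2`; so the two named facts
  `GrbacShahidi2015_partialAsaiL_at_one` and `Mok2014_partialAsaiL_continuation_pole_dichotomy` hang on
  one and the same analytic input (Langlands–Shahidi theory on `U(N, N)` with Mok's endoscopic
  classification, Grbac–Shahidi's Thm. 4.1/4.3) plus the Rankin–Selberg facts of Jacquet–Shalika.
  Compared with `Mok2014_partialAsaiL_continuation_pole_dichotomy_of_holomorphy_of_L2(_two_le)`
  (`AsaiSignContProofsL2`, `AsaiSignContOfL2TwoLe`) it needs NEITHER Mœglin–Waldspurger's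
  continuation `MoeglinWaldspurger1989_partialPairL_of_eq_conj` NOR the non-vanishing hypothesis
  `hNV` on removed unramified local factors: nothing is removed.
* `CuspidalAutomorphicRepData.exists_hasSatakeParamAt_iff_L2_of_isConjSelfDualAE` — **a conjugate
  self-dual cuspidal datum is `A_G`-normalised**: for a cuspidal Borel–Jacquet datum `Π` on
  `GL_N(𝔸_E)` conjugate self-dual a.e. there is a cuspidal `P ≤ L²_cusp(μ)` with THE SAME Satake
  parameters at every finite place (the pointwise Borel–Jacquet dictionary
  `exists_satake_eq_cpow_mul_L2_pointwise`, `t_{Π,w} = q_w^{z} t_{P,w}`, has `z = 0`), granted `h22'`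
  and `h23`.  Printed proofs read this off the central character (`Π ≅ Π₀ ⊗ |det|^z`, `Π₀` trivial on
  `A_G`, and `Π^c ≅ Π^∨` forces `ω_Π` trivial on `A_G`); here it is read off the Rankin–Selberg
  `L`-functions in `L²_cusp`: off a large finite `c`-stable set, conjugate self-duality
  `t_{Π, cw} = t_{Π,w}⁻¹` and `t⁻¹ = \bar t` for `L²` families (`IsSatakeFamilyOf.map_inv_eq_map_conj`)
  give `\bar t_{P,w} = q_w^{2z} t_{P, cw} = q_w^{2z} t_{U_c P, w}`, so that
  `L^T(s, P × P̄) = L^T(s - 2z, P × U_c P)`; the left side has a genuine pole at `s = 1` ((2.3), `h23`),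
  the right side a finite limit at `1 - 2z` if `2z ≠ 0` ((2.2) on `Re s = 1` off `1`, `h22'`;
  `Re z = 0` by the unitarity `|∏ t_{P,w}| = 1` of `L²` families at `w` and `cw`) — contradiction.
* `CuspidalAutomorphicRepData.pairL_pole_of_isConjSelfDualAE_of_L2` — **the Rankin–Selberg input
  `hRS` at EVERY Asai datum `(S, A)` of a conjugate self-dual `Π`**: `R(s) = L^{S_E}(s, A ⊗ A^c)` is
  multipliable and holomorphic on `{1 < Re s}` (Jacquet–Shalika I, Thm. (5.3): the theorems
  `JacquetShalika1981_multipliable_partialPairL_holds`, `differentiableOn_partialPairL_of_isSatakeFamilyOf`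
  for the pair `(P, U_c P)`) and `(s - 1) R(s) → r ≠ 0` as `s → 1⁺`: `A` is an `L²` family of `P` and
  `A ∘ c` one of the Galois conjugate `U_c P` (`IsSatakeFamilyOf.galConj`) off `S_E` ITSELF, and
  `P = \overline{U_c P}` as subspaces of `L²_cusp` — else (2.2) at `s₀ = 1` (`h22`, through `hm1`)
  at a large datum where `t_{U_c P} = \bar t_P` exactly contradicts the pole of `L(s, P × P̄)` (`h23`) —
  so (2.3) applies to `(P, U_c P)` with the families `(A, A ∘ c)` at the given `S`: the facts are
  keyed on the subspaces, not on the families, and no local factor has to be removed or restored.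
* `CuspidalAutomorphicRepData.hol_half_plane_of_asaiHolomorphyL2` — **`hHol` at every datum from
  `hGS`**: with `z = 0`, `A` is an `L²` family of `P` off `S_E` for the given `S`, `hGS` gives an entire
  `G = s (s - 1) L^S(s, Π, As^η)`, and `G / s` is the continuation of `(s - 1) L^S(s, Π, As^η)` to
  `{1/2 < Re s}`.

Mok's argument (§2.5, p. 20: "`L(s, φ^N × (φ^N)^c) = L(s, φ^N, As⁺) L(s, φ^N, As⁻)` … has a simple
pole at `s = 1` by [JPSS] … by Shahidi's theorem both are non-zero at `s = 1` … hence exactly one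
… has a pole at `s = 1`, which is a simple pole") is then the accepted
`Mok2014_partialAsaiL_continuation_pole_dichotomy_of_holomorphy` (order count at `s = 1`).

What this does NOT give: `hGS` (Grbac–Shahidi 2015, Thm. 4.3 (1), (2)(a): Langlands–Shahidi theory
on `U(N, N)`, Thm. 4.1 resting on Mok's endoscopic classification for `0 < Re s < 1/2`), the three
`L²` facts of Jacquet–Shalika and multiplicity one — named facts of the tree, resp. the requested
`GrbacShahidi2015_partialAsaiL_holomorphy`.  In rank `N = 1` everything is a theorem
(`Mok2014_partialAsaiL_continuation_pole_dichotomy_rank_one`, `AsaiSignContRankOne`).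

## References

* C. P. Mok, *Endoscopic classification of representations of quasi-split unitary groups*,
  Mem. Amer. Math. Soc. 235 (2015), no. 1108 (arXiv:1206.0882): §2.5, paragraph before Thm. 2.5.4,
  and Thm. 2.5.4 (a) (p. 20). [Mok2014]
* N. Grbac, F. Shahidi, *Endoscopic transfer for unitary groups and holomorphy of Asai
  `L`-functions*, Pacific J. Math. 276 (2015), 185–211: §2.A (normalisation on `A_G`, p. 190),
  Thm. 4.3 and its proof, pp. 204–206, Remark 4.4. [GrbacShahidi2015]
* J. Arthur, L. Clozel, *Simple algebras, base change, and the advanced theory of the trace formula*,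
  Ann. of Math. Stud. 120 (1989), Ch. 1 §2.1 (`Π^σ`), Ch. 3 §2 (2.1)–(2.3). [ArthurClozelAMS120]
* H. Jacquet, J. A. Shalika, *On Euler products and the classification of automorphic
  representations I, II*, Amer. J. Math. 103 (1981): I Thm. (5.3); II Prop. 3.6, Thm. 4.8.
  [JacquetShalikaAJM1981] [JacquetShalikaAJM1981II]
* A. Borel, H. Jacquet, *Automorphic forms and automorphic representations*, Corvallis 1979, 4.6, 5.7.
  [BorelJacquetCorvallis1979]
-/

noncomputable section

open scoped Topology
open NumberField IsDedekindDomain Filter Polynomial MeasureTheory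

namespace Literature.NumberTheory.Automorphic

open AdelicGroupData

/-! ### Two elementary lemmas -/

section Elementary

/-- A positive real number equal to its inverse is `1`. [folklore] -/
theorem eq_one_of_pos_of_eq_inv {t : ℝ} (ht : 0 < t) (h : t = t⁻¹) : t = 1 := by
  have h2 : t * t = 1 := by
    nth_rewrite 2 [h]
    exact mul_inv_cancel₀ ht.ne'
  rcases mul_self_eq_one_iff.mp h2 with h1 | h1
  · exact h1
  · linarith

/-- `∏ (u • m) = u ^ |m| ∏ m` for a multiset scaled entrywise. [folklore] -/
theorem Multiset.prod_map_const_mul (m : Multiset ℂ) (u : ℂ) :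
    (m.map (u * ·)).prod = u ^ Multiset.card m * m.prod := by
  rw [Multiset.prod_map_mul, Multiset.map_const', Multiset.prod_replicate, Multiset.map_id']

end Elementary

/-! ### Conjugate self-dual cuspidal data are `A_G`-normalised (the dictionary has no twist) -/

section Normalisation

variable {F E : Type} [Field F] [NumberField F] [Field E] [NumberField E] [Algebra F E]
  {N : ℕ} {hcpt : isCompact_glFiniteIntegralLevel N E}

/-- **A conjugate self-dual cuspidal datum has the Satake parameters of a cuspidal
`P ≤ L²_cusp(GL_N(E) A_G \ GL_N(𝔸_E))` at every finite place** (no twist `|det|^z`), granted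
Jacquet–Shalika's (2.2) on `Re s = 1` off `s = 1` (`h22'`) and (2.3) (`h23`) in `L²_cusp`.  By the
pointwise Borel–Jacquet dictionary (`exists_satake_eq_cpow_mul_L2_pointwise`, Borel–Jacquet 5.7)
`t_{Π,v} = q_v^{z} t_{P,v}` at every `v`; we show `z = 0`.  Off a finite `c`-stable set `T` containing
the exceptional set of an `L²` family `α` of `P` and the failure set of `t_{Π,cw} = t_{Π,w}⁻¹`:
(i) `Re z = 0` — `|∏ t_{Π,w}| = |q_w^{z}|^N = |∏ t_{Π,cw}| = |∏ t_{Π,w}|⁻¹` by `|∏ α(w)| = 1`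
(`HasSatakeParameterAt.norm_prod_eq_one`) at `w` and `cw`; (ii) `\bar α(w) = α(w)⁻¹ = q_w^{2z} α(cw)`
(`IsSatakeFamilyOf.map_inv_eq_map_conj`), and `w ↦ α(cw)` is an `L²` family of the Galois conjugate
`U_c P` (`IsSatakeFamilyOf.galConj`), so `L^T(s, P × P̄) = L^T(s - 2z, P × U_c P)`
(`partialPairL_eq_of_shift`); if `2z ≠ 0` the right side has a finite limit as `s - 2z → 1 - 2z`
(`h22'` at `1 - 2z ≠ 1`, `Re = 1`) while the left side has a genuine pole at `s = 1` (`h23` for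
`(P, P̄)`, `not_tendsto_partialPairL_conj_of_pole`) — contradiction.  (Grbac–Shahidi, §2.A p. 190:
"We always assume that `Σ` is … trivial on `A_P(F_∞)°` … obtained by twisting by a unitary
character"; for `Σ^θ ≅ Σ̃` no twist is needed.)
[cite: GrbacShahidi2015, §2.A p. 190] [cite: ArthurClozelAMS120, Ch. 3 §2 (2.2)–(2.3)]
[cite: BorelJacquetCorvallis1979, 5.7] -/
theorem CuspidalAutomorphicRepData.exists_hasSatakeParamAt_iff_L2_of_isConjSelfDualAE
    (h22' : ∀ (μ : Measure (gl N E).automorphicQuotient) [(gl N E).IsAutomorphicMeasure μ],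
      JacquetShalika1981_partialPairL_boundary_of_ne_one (n := N) (m := N) (K := E) (μ := μ)
        (μ' := μ))
    (h23 : ∀ (μ : Measure (gl N E).automorphicQuotient) [(gl N E).IsAutomorphicMeasure μ],
      JacquetShalika1981_partialPairL_pole_of_eq_conj (n := N) (K := E) (μ := μ))
    {c : E ≃ₐ[F] E} (hcc : c * c = 1) (hN : 0 < N) (π : CuspidalAutomorphicRepData N E hcpt)
    (hπ : π.1.IsConjSelfDualAE c)
    (μ : Measure (gl N E).automorphicQuotient) [(gl N E).IsAutomorphicMeasure μ] :
    ∃ P : CuspidalAutomorphicRepGL N E μ, ∀ (v : HeightOneSpectrum (𝓞 E)) (β : Multiset ℂ),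
      π.1.HasSatakeParamAt v β ↔
        ∃ (𝔫 : Ideal (𝓞 E)) (ϖ : (v.adicCompletion E)ˣ), 𝔫 ≠ 0 ∧ ¬ v.asIdeal ∣ 𝔫 ∧
          HasSatakeParameterAt P.1 (principalCongruenceLevel N E 𝔫) v ϖ β := by
  classical
  haveI : NeZero N := ⟨hN.ne'⟩
  haveI := infinite_heightOneSpectrum E
  have hμG : IsGalInvariant F μ :=
    isGalInvariant_of_unique F (isAutomorphicMeasure_unique_smul_holds N E) μ
  obtain ⟨π₀, h0W', h0π⟩ :=
    CuspidalAutomorphicRepData.exists_clean_hasSatakeParamAt_iff_of_sSup_irreducible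
      (AutomorphicRepsGL.stable_cuspidal_eq_sSup_irreducible_holds (hcpt := hcpt)) π
  obtain ⟨z, P, S₁, αP, hS₁, hαP, hdict₁, hdict⟩ :=
    CuspidalAutomorphicRepData.exists_satake_eq_cpow_mul_L2_pointwise
      (AutomorphicRepsGL.exists_isAssociatedL2_holds hcpt μ) (hasSatakeParamAt_iff_L2_holds hcpt μ)
      π π₀ h0W' h0π
  -- it suffices to show that the twist vanishes
  suffices hz : z = 0 by
    subst hz
    refine ⟨P, fun v β => ?_⟩
    rw [hdict v β]
    simp only [neg_zero, Complex.cpow_zero, one_mul, Multiset.map_id']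
  -- the finite failure set `B` of conjugate self-duality, and a finite `c`-stable `SE ⊇ S₁ ∪ B`
  set B : Set (HeightOneSpectrum (𝓞 E)) := {w | ¬ ∀ α β : Multiset ℂ,
      π.1.HasSatakeParamAt w α → π.1.HasSatakeParamAt (c • w) β → β = α.map (·⁻¹)} with hB
  have hBfin : B.Finite := Filter.eventually_cofinite.mp hπ
  set S : Set (HeightOneSpectrum (𝓞 F)) :=
    (fun w : HeightOneSpectrum (𝓞 E) => w.under (𝓞 F)) '' (S₁ ∪ B) with hS
  have hSfin : S.Finite := (hS₁.union hBfin).image _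
  set SE : Set (HeightOneSpectrum (𝓞 E)) := {w | w.under (𝓞 F) ∈ S} with hSE
  have hSEfin : SE.Finite := finite_setOf_under_mem hSfin
  have hS₁SE : S₁ ⊆ SE := fun w hw => ⟨w, Or.inl hw, rfl⟩
  have hcS₁SE : (c • ·) ⁻¹' S₁ ⊆ SE := fun w hw => by
    show w.under (𝓞 F) ∈ S
    rw [← HeightOneSpectrum.under_algEquiv_smul F E c w]
    exact ⟨c • w, Or.inl hw, rfl⟩
  have hcSE : ∀ w : HeightOneSpectrum (𝓞 E), w ∉ SE → c • w ∉ SE := fun w hw h => hw (by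
    have h' : (c • w).under (𝓞 F) ∈ S := h
    rwa [HeightOneSpectrum.under_algEquiv_smul] at h')
  have hgood : ∀ w : HeightOneSpectrum (𝓞 E), w ∉ SE → ∀ α β : Multiset ℂ,
      π.1.HasSatakeParamAt w α → π.1.HasSatakeParamAt (c • w) β → β = α.map (·⁻¹) := by
    intro w hw
    by_contra h
    exact hw ⟨w, Or.inr h, rfl⟩
  -- the Satake family `t_Π = q^z α` of `Π` off `S₁`, conjugate self-dual EXACTLY off `SE`
  set A₀ : SatakeFamily E := fun w => (αP w).map (((w.residueCard : ℂ) ^ z) * ·) with hA₀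
  have hA₀π : ∀ w : HeightOneSpectrum (𝓞 E), w ∉ SE → π.1.HasSatakeParamAt w (A₀ w) :=
    fun w hw => (hdict₁ w (fun h => hw (hS₁SE h)) (A₀ w)).mpr rfl
  have hcsd : ∀ w : HeightOneSpectrum (𝓞 E), w ∉ SE → A₀ (c • w) = (A₀ w).map (·⁻¹) :=
    fun w hw => hgood w hw _ _ (hA₀π w hw) (hA₀π (c • w) (hcSE w hw))
  -- the `L²` families off `SE`: `α` of `P`, `α ∘ c` of `U_c P`, `\bar α` of `P̄`
  have hα : IsSatakeFamilyOf P SE αP := hαP.mono hS₁SE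
  have hcinv : c⁻¹ = c := inv_eq_of_mul_eq_one_right hcc
  set Pc : CuspidalAutomorphicRepGL N E μ := P.galConj F hμG c with hPc
  have hβ₀ : IsSatakeFamilyOf Pc ((c • ·) ⁻¹' S₁) (fun w => αP (c • w)) := by
    have h := hαP.galConj F hμG c
    rw [hcinv] at h
    exact h
  have hβ : IsSatakeFamilyOf Pc SE (fun w => αP (c • w)) := hβ₀.mono hcS₁SE
  -- (i) `Re z = 0` by unitarity at `w₀` and `c w₀`
  have hzre : z.re = 0 := by
    have hev : ∀ᶠ w : HeightOneSpectrum (𝓞 E) in cofinite, w ∉ SE := hSEfin.compl_mem_cofinite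
    obtain ⟨w₀, hw₀⟩ := hev.exists
    obtain ⟨𝔫, -, -, ϖ, hSat⟩ := hα w₀ hw₀
    obtain ⟨𝔫', -, -, ϖ', hSat'⟩ := hβ w₀ hw₀
    set u : ℂ := (w₀.residueCard : ℂ) ^ z with hu
    have hq0 : (w₀.residueCard : ℂ) ≠ 0 := by
      exact_mod_cast (zero_lt_one.trans w₀.one_lt_residueCard).ne'
    have hu0 : u ≠ 0 := fun h => hq0 ((Complex.cpow_eq_zero_iff _ _).mp h).1
    have hx : ‖(A₀ w₀).prod‖ = ‖u‖ ^ N := by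
      show ‖((αP w₀).map (u * ·)).prod‖ = ‖u‖ ^ N
      rw [Multiset.prod_map_const_mul, norm_mul, norm_pow, hSat.norm_prod_eq_one, mul_one,
        hSat.card_eq]
    have hy : ‖(A₀ (c • w₀)).prod‖ = ‖u‖ ^ N := by
      show ‖((αP (c • w₀)).map ((((c • w₀).residueCard : ℂ) ^ z) * ·)).prod‖ = ‖u‖ ^ N
      rw [residueCard_smul F c w₀, Multiset.prod_map_const_mul, norm_mul, norm_pow,
        hSat'.norm_prod_eq_one, mul_one, hSat'.card_eq]
    have hinv : ‖(A₀ (c • w₀)).prod‖ = ‖(A₀ w₀).prod‖⁻¹ := by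
      rw [hcsd w₀ hw₀, Multiset.prod_map_inv', norm_inv]
    rw [hx, hy] at hinv
    have ht : ‖u‖ ^ N = 1 := eq_one_of_pos_of_eq_inv (pow_pos (norm_pos_iff.mpr hu0) N) hinv
    have h1 : ‖(A₀ w₀).prod‖ = 1 := by rw [hx, ht]
    exact re_eq_zero_of_norm_prod_eq_one_of_shift hα hN hw₀ rfl h1
  -- (ii) `\bar α(w) = q_w^{2z} α(c w)` off `SE`
  have hrel : ∀ w : HeightOneSpectrum (𝓞 E), w ∉ SE →
      (αP w).map (starRingEnd ℂ) = (αP (c • w)).map (((w.residueCard : ℂ) ^ (z + z)) * ·) := by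
    intro w hw
    have hq0 : (w.residueCard : ℂ) ≠ 0 := by
      exact_mod_cast (zero_lt_one.trans w.one_lt_residueCard).ne'
    have hqz : (w.residueCard : ℂ) ^ z ≠ 0 := fun h => hq0 ((Complex.cpow_eq_zero_iff _ _).mp h).1
    have h2 : (αP (c • w)).map (((w.residueCard : ℂ) ^ z) * ·) =
        ((αP w).map (((w.residueCard : ℂ) ^ z) * ·)).map (·⁻¹) := by
      have h := hcsd w hw
      simp only [hA₀, residueCard_smul F c w] at h
      exact h
    have h3 : (αP w).map (·⁻¹) =
        ((αP (c • w)).map (((w.residueCard : ℂ) ^ z) * ·)).map (((w.residueCard : ℂ) ^ z) * ·) := by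
      rw [h2, Multiset.map_map, Multiset.map_map]
      refine Multiset.map_congr rfl fun a _ => ?_
      show a⁻¹ = (w.residueCard : ℂ) ^ z * ((w.residueCard : ℂ) ^ z * a)⁻¹
      rw [mul_inv, ← mul_assoc, mul_inv_cancel₀ hqz, one_mul]
    rw [← hα.map_inv_eq_map_conj hw, h3, Multiset.map_map]
    refine Multiset.map_congr rfl fun a _ => ?_
    show (w.residueCard : ℂ) ^ z * ((w.residueCard : ℂ) ^ z * a) = (w.residueCard : ℂ) ^ (z + z) * a
    rw [← mul_assoc, ← Complex.cpow_add _ _ hq0]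
  -- (iii) if `2z ≠ 0`: `L^T(s, P × P̄) = L^T(s - 2z, P × U_c P)` has both a pole and a finite limit at `1`
  by_contra hz
  have hzz0 : z + z ≠ 0 := fun h => hz (add_self_eq_zero.mp h)
  have hzzre : ((0 : ℂ) + (z + z)).re = 0 := by
    rw [zero_add, Complex.add_re, hzre, add_zero]
  have hα0 : ∀ w : HeightOneSpectrum (𝓞 E), w ∉ SE →
      αP w = (αP w).map (((w.residueCard : ℂ) ^ (0 : ℂ)) * ·) := fun w _ => by
    rw [Complex.cpow_zero]
    simp only [one_mul, Multiset.map_id']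
  have hs₀ : ((1 : ℂ) - (0 + (z + z))).re = 1 := by
    rw [Complex.sub_re, hzzre, Complex.one_re, sub_zero]
  have hs₁ : (1 : ℂ) - (0 + (z + z)) ≠ 1 := by
    rw [zero_add]
    exact fun h => hzz0 (sub_eq_self.mp h)
  obtain ⟨r, -, hT⟩ := (h22' μ) hN hN P Pc hSEfin hα hβ hs₀ hs₁
  have hT' : Tendsto (partialPairL SE αP fun w => (αP w).map (starRingEnd ℂ))
      (𝓝[{s : ℂ | 1 < s.re}] 1) (𝓝 r) :=
    tendsto_partialPairL_of_shift' hα0 hrel hzzre hT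
  exact not_tendsto_partialPairL_conj_of_pole (h23 μ) hN P P.conj P.conj_conj.symm hSEfin hα
    hα.conj r hT'

end Normalisation

/-! ### The Rankin–Selberg input and the holomorphy at EVERY Asai datum -/

section Datum

variable {F E : Type} [Field F] [NumberField F] [Field E] [NumberField E] [Algebra F E]
  {N : ℕ} {hcpt : isCompact_glFiniteIntegralLevel N E}

/-- **`hRS` at every Asai datum of a conjugate self-dual `Π`, from the `L²` facts.** For a
quadratic `E/F` with involution `c` (`c² = 1`), a cuspidal `Π` on `GL_N(𝔸_E)` (`N ≥ 1`) conjugate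
self-dual a.e. and ANY Asai datum `(S, A)` of `Π`: the raw product `R(s) = L^{S_E}(s, A ⊗ A^c)` is
multipliable and holomorphic on `{1 < Re s}`, and `(s - 1) R(s) → r ≠ 0` as `s → 1`, `Re s > 1`
(Mok, §2.5 p. 20: "`L(s, φ^N × (φ^N)^c) = … = L(s, φ^N × (φ^N)^∨)`, hence has a simple pole at `s = 1`
by [JPSS]"; Grbac–Shahidi p. 206).  Proof: by `exists_hasSatakeParamAt_iff_L2_of_isConjSelfDualAE`,
`A` is an `L²` family of a cuspidal `P ≤ L²_cusp(μ)` off `S_E` and `A ∘ c` one of `U_c P`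
(`IsSatakeFamilyOf.galConj`; `μ` is `Gal(E/F)`-invariant, `isGalInvariant_of_unique`);
multipliability and holomorphy are Jacquet–Shalika I, Thm. (5.3), for `(P, U_c P)`
(`JacquetShalika1981_multipliable_partialPairL_holds`, `differentiableOn_partialPairL_of_isSatakeFamilyOf`).
Moreover `P = \overline{U_c P}` in `L²_cusp`: otherwise (2.2) at `s₀ = 1` (`h22`, through `hm1`) for
`(P, U_c P)` at the datum enlarged by the finite failure set of `A(cw) = A(w)⁻¹`, where
`A ∘ c = A⁻¹ = \bar A` exactly (`IsSatakeFamilyOf.map_inv_eq_map_conj`) and so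
`L(s, P × U_c P) = L(s, P × P̄)` factor by factor, contradicts the pole of the latter ((2.3), `h23`,
`not_tendsto_partialPairL_conj_of_pole`).  Hence (2.3) applies to `(P, U_c P)` with the families
`(A, A ∘ c)` off the ORIGINAL `S_E`. [cite: Mok2014, §2.5 p. 20]
[cite: GrbacShahidi2015, proof of Thm. 4.3, p. 206] [cite: ArthurClozelAMS120, Ch. 3 §2 (2.1)–(2.3)] -/
theorem CuspidalAutomorphicRepData.pairL_pole_of_isConjSelfDualAE_of_L2
    (h22 : ∀ (μ : Measure (gl N E).automorphicQuotient) [(gl N E).IsAutomorphicMeasure μ],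
      JacquetShalika1981_partialPairL_at_one_of_ne_conj (n := N) (K := E) (μ := μ))
    (h22' : ∀ (μ : Measure (gl N E).automorphicQuotient) [(gl N E).IsAutomorphicMeasure μ],
      JacquetShalika1981_partialPairL_boundary_of_ne_one (n := N) (m := N) (K := E) (μ := μ)
        (μ' := μ))
    (h23 : ∀ (μ : Measure (gl N E).automorphicQuotient) [(gl N E).IsAutomorphicMeasure μ],
      JacquetShalika1981_partialPairL_pole_of_eq_conj (n := N) (K := E) (μ := μ))
    (hm1 : ∀ (μ : Measure (gl N E).automorphicQuotient) [(gl N E).IsAutomorphicMeasure μ],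
      multiplicity_one_gl N E μ)
    {c : E ≃ₐ[F] E} (hcc : c * c = 1) (hN : 0 < N) (π : CuspidalAutomorphicRepData N E hcpt)
    (hπ : π.1.IsConjSelfDualAE c) {S : Set (HeightOneSpectrum (𝓞 F))} {A : SatakeFamily E}
    (hSA : π.1.IsAsaiDatum c S A) :
    (∀ s : ℂ, 1 < s.re →
      Multipliable fun w : {w : HeightOneSpectrum (𝓞 E) // w.under (𝓞 F) ∉ S} =>
        ((satakePairPolynomial (A w.1) (A (c • w.1))).eval ((w.1.residueCard : ℂ) ^ (-s)))⁻¹) ∧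
    DifferentiableOn ℂ
      (partialPairL {w : HeightOneSpectrum (𝓞 E) | w.under (𝓞 F) ∈ S} A (fun w => A (c • w)))
      {s : ℂ | 1 < s.re} ∧
    ∃ r : ℂ, r ≠ 0 ∧
      Tendsto (fun s => (s - 1) *
          partialPairL {w : HeightOneSpectrum (𝓞 E) | w.under (𝓞 F) ∈ S} A (fun w => A (c • w)) s)
        (𝓝[{s : ℂ | 1 < s.re}] 1) (𝓝 r) := by
  classical
  haveI : NeZero N := ⟨hN.ne'⟩
  obtain ⟨μ, hμ⟩ := AdelicGroupData.exists_isAutomorphicMeasure_gl_holds (n := N) (K := E)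
  haveI := hμ
  have hμG : IsGalInvariant F μ :=
    isGalInvariant_of_unique F (isAutomorphicMeasure_unique_smul_holds N E) μ
  obtain ⟨P, hdict⟩ := π.exists_hasSatakeParamAt_iff_L2_of_isConjSelfDualAE h22' h23 hcc hN hπ μ
  set SE : Set (HeightOneSpectrum (𝓞 E)) := {w | w.under (𝓞 F) ∈ S} with hSE
  have hSEfin : SE.Finite := finite_setOf_under_mem hSA.finite
  -- `A` is an `L²` family of `P` off `S_E`, `A ∘ c` one of `U_c P`
  have hα : IsSatakeFamilyOf P SE A := by
    intro w hw
    obtain ⟨𝔫, ϖ, h𝔫, hw𝔫, hSat⟩ := (hdict w (A w)).mp (hSA.hasSatakeParamAt hw)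
    exact ⟨𝔫, h𝔫, hw𝔫, ϖ, hSat⟩
  have hcinv : c⁻¹ = c := inv_eq_of_mul_eq_one_right hcc
  set Pc : CuspidalAutomorphicRepGL N E μ := P.galConj F hμG c with hPc
  have hβ : IsSatakeFamilyOf Pc SE (fun w => A (c • w)) := by
    have h := hα.galConj F hμG c
    rw [hcinv] at h
    refine h.mono fun w hw => ?_
    show w.under (𝓞 F) ∈ S
    have hw' : (c • w).under (𝓞 F) ∈ S := hw
    rwa [HeightOneSpectrum.under_algEquiv_smul] at hw'
  -- `P = conj (U_c P)` in `L²_cusp`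
  have hPeq : P = Pc.conj := by
    by_contra hne
    set B : Set (HeightOneSpectrum (𝓞 E)) := {w | ¬ ∀ α β : Multiset ℂ,
        π.1.HasSatakeParamAt w α → π.1.HasSatakeParamAt (c • w) β → β = α.map (·⁻¹)} with hB
    have hBfin : B.Finite := Filter.eventually_cofinite.mp hπ
    set S'' : Set (HeightOneSpectrum (𝓞 F)) :=
      S ∪ (fun w : HeightOneSpectrum (𝓞 E) => w.under (𝓞 F)) '' B with hS''
    have hS''fin : S''.Finite := hSA.finite.union (hBfin.image _)
    set SE'' : Set (HeightOneSpectrum (𝓞 E)) := {w | w.under (𝓞 F) ∈ S''} with hSE''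
    have hSE''fin : SE''.Finite := finite_setOf_under_mem hS''fin
    have hsub : SE ⊆ SE'' := fun w hw => Or.inl hw
    have hα'' : IsSatakeFamilyOf P SE'' A := hα.mono hsub
    have hβ'' : IsSatakeFamilyOf Pc SE'' (fun w => A (c • w)) := hβ.mono hsub
    -- off `SE''` the pair factor of `(A, A ∘ c)` is that of `(A, \bar A)`
    have key : ∀ w : HeightOneSpectrum (𝓞 E), w ∉ SE'' → A (c • w) = (A w).map (starRingEnd ℂ) := by
      intro w hw
      have hwS : w.under (𝓞 F) ∉ S := fun h => hw (Or.inl h)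
      have hcwS : (c • w).under (𝓞 F) ∉ S := by
        rwa [HeightOneSpectrum.under_algEquiv_smul]
      have hgood : ∀ α β : Multiset ℂ, π.1.HasSatakeParamAt w α →
          π.1.HasSatakeParamAt (c • w) β → β = α.map (·⁻¹) := by
        by_contra h
        exact hw (Or.inr ⟨w, h, rfl⟩)
      rw [hgood _ _ (hSA.hasSatakeParamAt hwS) (hSA.hasSatakeParamAt hcwS)]
      exact hα.map_inv_eq_map_conj hwS
    have hLL : partialPairL SE'' A (fun w => A (c • w)) =
        partialPairL SE'' A (fun w => (A w).map (starRingEnd ℂ)) := by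
      funext s
      unfold partialPairL
      exact tprod_congr fun w => by simp only [key w.1 w.2]
    obtain ⟨r, -, hT⟩ := (h22 μ) hN (hm1 μ) P Pc hne hSE''fin hα'' hβ''
    rw [hLL] at hT
    exact not_tendsto_partialPairL_conj_of_pole (h23 μ) hN P P.conj P.conj_conj.symm hSE''fin hα''
      hα''.conj r hT
  -- (2.1), Thm. (5.3) and (2.3) for `(P, U_c P)` with the families `(A, A ∘ c)` off `S_E`
  refine ⟨fun s hs => JacquetShalika1981_multipliable_partialPairL_holds P Pc hα hβ hs,
    differentiableOn_partialPairL_of_isSatakeFamilyOf P Pc hα hβ, ?_⟩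
  exact (h23 μ) hN P Pc hPeq hSEfin hα hβ

/-- **`hHol` at every Asai datum of a conjugate self-dual `Π`, from `hGS`.** Granted Grbac–Shahidi's
Thm. 4.3 (1), (2)(a) for the partial Asai `L`-functions of the cuspidal `Π₀ ≤ L²_cusp(μ)` (the
hypothesis `hGS` of `CuspidalAutomorphicRepData.hol_of_asaiHolomorphyL2`, verbatim) and
Jacquet–Shalika's `h22'`, `h23`: for `Π` cuspidal on `GL_N(𝔸_E)` (`N ≥ 1`) conjugate self-dual a.e.,
an Asai datum `(S, A)` and a sign `η`, the function `(s - 1) L^S(s, Π, As^η)` continues from some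
`{σ₀ < Re s}` (`σ₀ ≥ 1`) to a holomorphic function on `{1/2 < Re s}` — namely `G(s) / s` for the
entire `G = s (s - 1) L^S(s, P, As^η)` of `hGS` at the datum `(P, S, A)`, `P ≤ L²_cusp(μ)` having the
Satake parameters of `Π` (`exists_hasSatakeParamAt_iff_L2_of_isConjSelfDualAE`).
[cite: GrbacShahidi2015, Thm. 4.3 (2)(a)] [cite: Mok2014, §2.5 p. 20] -/
theorem CuspidalAutomorphicRepData.hol_half_plane_of_asaiHolomorphyL2
    (hGS : ∀ (F E : Type) [Field F] [NumberField F] [Field E] [NumberField E] [Algebra F E]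
      (c : E ≃ₐ[F] E), Module.finrank F E = 2 → c ≠ 1 →
      ∀ (N : ℕ) (μ : Measure (gl N E).automorphicQuotient) [(gl N E).IsAutomorphicMeasure μ]
        (P : CuspidalAutomorphicRepGL N E μ), 0 < N →
        ∀ (S : Set (HeightOneSpectrum (𝓞 F))) (A : SatakeFamily E) (η : ℤˣ), S.Finite →
          IsSatakeFamilyOf P {w : HeightOneSpectrum (𝓞 E) | w.under (𝓞 F) ∈ S} A →
          (∀ w : HeightOneSpectrum (𝓞 E), w.under (𝓞 F) ∉ S → c • w = w →
            w.asIdeal.inertiaDeg (𝓞 F) = 2) →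
          ∃ σ₀ : ℝ, 1 ≤ σ₀ ∧
            (∃ G : ℂ → ℂ, Differentiable ℂ G ∧
              ∀ s : ℂ, σ₀ < s.re → G s = s * (s - 1) * partialAsaiL S c A η s) ∧
            ((¬ ∀ᶠ w : HeightOneSpectrum (𝓞 E) in cofinite, A (c • w) = (A w).map (·⁻¹)) →
              ∃ H : ℂ → ℂ, Differentiable ℂ H ∧
                ∀ s : ℂ, σ₀ < s.re → H s = partialAsaiL S c A η s))
    (h22' : ∀ (μ : Measure (gl N E).automorphicQuotient) [(gl N E).IsAutomorphicMeasure μ],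
      JacquetShalika1981_partialPairL_boundary_of_ne_one (n := N) (m := N) (K := E) (μ := μ)
        (μ' := μ))
    (h23 : ∀ (μ : Measure (gl N E).automorphicQuotient) [(gl N E).IsAutomorphicMeasure μ],
      JacquetShalika1981_partialPairL_pole_of_eq_conj (n := N) (K := E) (μ := μ))
    (h2 : Module.finrank F E = 2) {c : E ≃ₐ[F] E} (hc : c ≠ 1) (hN : 0 < N)
    (π : CuspidalAutomorphicRepData N E hcpt) (hπ : π.1.IsConjSelfDualAE c)
    {S : Set (HeightOneSpectrum (𝓞 F))} {A : SatakeFamily E} (η : ℤˣ)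
    (hSA : π.1.IsAsaiDatum c S A) :
    ∃ σ₀ : ℝ, 1 ≤ σ₀ ∧ ∃ G : ℂ → ℂ, DifferentiableOn ℂ G {s : ℂ | 1 / 2 < s.re} ∧
      ∀ s : ℂ, σ₀ < s.re → G s = (s - 1) * partialAsaiL S c A η s := by
  classical
  haveI : NeZero N := ⟨hN.ne'⟩
  have hcc : c * c = 1 := AlgEquiv.mul_self_eq_one_of_finrank_eq_two h2 c
  obtain ⟨μ, hμ⟩ := AdelicGroupData.exists_isAutomorphicMeasure_gl_holds (n := N) (K := E)
  haveI := hμ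
  obtain ⟨P, hdict⟩ := π.exists_hasSatakeParamAt_iff_L2_of_isConjSelfDualAE h22' h23 hcc hN hπ μ
  have hα : IsSatakeFamilyOf P {w : HeightOneSpectrum (𝓞 E) | w.under (𝓞 F) ∈ S} A := by
    intro w hw
    obtain ⟨𝔫, ϖ, h𝔫, hw𝔫, hSat⟩ := (hdict w (A w)).mp (hSA.hasSatakeParamAt hw)
    exact ⟨𝔫, h𝔫, hw𝔫, ϖ, hSat⟩
  have hinert : ∀ w : HeightOneSpectrum (𝓞 E), w.under (𝓞 F) ∉ S → c • w = w →
      w.asIdeal.inertiaDeg (𝓞 F) = 2 := fun w hw hcw => hSA.inertiaDeg_eq_two hw hcw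
  obtain ⟨σ₀, hσ₀, ⟨G, hG, hGL⟩, -⟩ := hGS F E c h2 hc N μ P hN S A η hSA.finite hα hinert
  refine ⟨σ₀, hσ₀, fun s => G s / s, ?_, ?_⟩
  · intro s hs
    have hs0 : s ≠ 0 := by
      rintro rfl
      simp only [Set.mem_setOf_eq, Complex.zero_re] at hs
      linarith
    exact ((hG s).div differentiableAt_id hs0).differentiableWithinAt
  · intro s hs
    have hs0 : s ≠ 0 := by
      rintro rfl
      rw [Complex.zero_re] at hs
      linarith
    show G s / s = (s - 1) * partialAsaiL S c A η s
    rw [hGL s hs, mul_assoc, mul_div_cancel_left₀ _ hs0]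

end Datum

/-! ### Mok's dichotomy from `hGS` and the `L²` facts -/

section Assembly

/-- **Mok's Asai-pole dichotomy (`Mok2014_partialAsaiL_continuation_pole_dichotomy`) from
Grbac–Shahidi's HOLOMORPHY in `L²_cusp` and the `L²` facts of Jacquet–Shalika.** Hypotheses — the
same five, verbatim, as `GrbacShahidi2015_partialAsaiL_at_one_of_asaiHolomorphy_of_L2`
(`AsaiAtOneOfAsaiHolomorphy`):

* `hGS` — Grbac–Shahidi 2015, Thm. 4.3 (1) and (2)(a), holomorphy clauses, for the partial Asai
  `L`-functions of both signs of every cuspidal `Π₀ ≤ L²_cusp(GL_N(E) A_G \ GL_N(𝔸_E))` (the printed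
  normalisation, §2.A p. 190), in the form requested as the cite item / named fact
  `GrbacShahidi2015_partialAsaiL_holomorphy`: `s (s - 1) L^S(s, Π₀, As^η)` is the restriction of an
  entire function, and so is `L^S(s, Π₀, As^η)` unless `Π₀` is conjugate self-dual a.e.;
* `h22`, `h22'`, `h23`, `hm1` — the tree's NAMED FACTS `JacquetShalika1981_partialPairL_at_one_of_ne_conj`,
  `JacquetShalika1981_partialPairL_boundary_of_ne_one` (equal ranks, one measure),
  `JacquetShalika1981_partialPairL_pole_of_eq_conj` and `multiplicity_one_gl`, over every number field,
  in every rank, for every automorphic measure.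

Proof: the accepted `Mok2014_partialAsaiL_continuation_pole_dichotomy_of_holomorphy` (Mok's order
count at `s = 1` from `L^{S_E}(s, Π × Π^c) = L^S(As⁺) L^S(As⁻)`) with `hHol` supplied by
`CuspidalAutomorphicRepData.hol_half_plane_of_asaiHolomorphyL2` and `hRS` by
`CuspidalAutomorphicRepData.pairL_pole_of_isConjSelfDualAE_of_L2`, at every Asai datum.
[cite: Mok2014, §2.5 (paragraph before Thm. 2.5.4) and Thm. 2.5.4 (a), p. 20]
[cite: GrbacShahidi2015, Thm. 4.3 and its proof, pp. 204–206]
[cite: ArthurClozelAMS120, Ch. 3 §2 (2.1)–(2.3)] [cite: BorelJacquetCorvallis1979, 4.6, 5.7] -/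
theorem Mok2014_partialAsaiL_continuation_pole_dichotomy_of_asaiHolomorphy_of_L2
    (hGS : ∀ (F E : Type) [Field F] [NumberField F] [Field E] [NumberField E] [Algebra F E]
      (c : E ≃ₐ[F] E), Module.finrank F E = 2 → c ≠ 1 →
      ∀ (N : ℕ) (μ : Measure (gl N E).automorphicQuotient) [(gl N E).IsAutomorphicMeasure μ]
        (P : CuspidalAutomorphicRepGL N E μ), 0 < N →
        ∀ (S : Set (HeightOneSpectrum (𝓞 F))) (A : SatakeFamily E) (η : ℤˣ), S.Finite →
          IsSatakeFamilyOf P {w : HeightOneSpectrum (𝓞 E) | w.under (𝓞 F) ∈ S} A →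
          (∀ w : HeightOneSpectrum (𝓞 E), w.under (𝓞 F) ∉ S → c • w = w →
            w.asIdeal.inertiaDeg (𝓞 F) = 2) →
          ∃ σ₀ : ℝ, 1 ≤ σ₀ ∧
            (∃ G : ℂ → ℂ, Differentiable ℂ G ∧
              ∀ s : ℂ, σ₀ < s.re → G s = s * (s - 1) * partialAsaiL S c A η s) ∧
            ((¬ ∀ᶠ w : HeightOneSpectrum (𝓞 E) in cofinite, A (c • w) = (A w).map (·⁻¹)) →
              ∃ H : ℂ → ℂ, Differentiable ℂ H ∧
                ∀ s : ℂ, σ₀ < s.re → H s = partialAsaiL S c A η s))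
    (h22 : ∀ (E : Type) [Field E] [NumberField E] (N : ℕ)
      (μ : Measure (gl N E).automorphicQuotient) [(gl N E).IsAutomorphicMeasure μ],
      JacquetShalika1981_partialPairL_at_one_of_ne_conj (n := N) (K := E) (μ := μ))
    (h22' : ∀ (E : Type) [Field E] [NumberField E] (N : ℕ)
      (μ : Measure (gl N E).automorphicQuotient) [(gl N E).IsAutomorphicMeasure μ],
      JacquetShalika1981_partialPairL_boundary_of_ne_one (n := N) (m := N) (K := E) (μ := μ)
        (μ' := μ))
    (h23 : ∀ (E : Type) [Field E] [NumberField E] (N : ℕ)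
      (μ : Measure (gl N E).automorphicQuotient) [(gl N E).IsAutomorphicMeasure μ],
      JacquetShalika1981_partialPairL_pole_of_eq_conj (n := N) (K := E) (μ := μ))
    (hm1 : ∀ (E : Type) [Field E] [NumberField E] (N : ℕ)
      (μ : Measure (gl N E).automorphicQuotient) [(gl N E).IsAutomorphicMeasure μ],
      multiplicity_one_gl N E μ) :
    Mok2014_partialAsaiL_continuation_pole_dichotomy := by
  refine Mok2014_partialAsaiL_continuation_pole_dichotomy_of_holomorphy ?_ ?_
  · intro F E _ _ _ _ _ c h2 hc N hcpt π hN hπ S A η hSA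
    exact π.hol_half_plane_of_asaiHolomorphyL2 hGS (h22' E N) (h23 E N) h2 hc hN hπ η hSA
  · intro F E _ _ _ _ _ c h2 hc N hcpt π hN hπ S A hSA
    exact π.pairL_pole_of_isConjSelfDualAE_of_L2 (h22 E N) (h22' E N) (h23 E N) (hm1 E N)
      (AlgEquiv.mul_self_eq_one_of_finrank_eq_two h2 c) hN hπ hSA

end Assembly

end Literature.NumberTheory.Automorphic
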